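import Summits.QuantumFields.YangMills.Theorems.UnitScaleTiltFluctuationComparisonRegPrAnsatzTKernel

/-!
# Route `UnitScaleTilt` — crux K1bR-pr `FluctuationComparisonRegPrL` (stmt-QuantumFields-19935, ex 19201), stub `stub_oneStepSmallLift`
# (W7 line), «ANSATZ T» part 3a — THE BOX FUNCTIONAL: coefficient functions on the coarse box `[-2,2]³` against an
# orientation/displacement-indexed field, shifts, norms, and the conversion from the fleet's displacement sums
# (support file `--supports stmt-QuantumFields-19935`)

Cell `ym3-torus` (rung R3), seat `ym3-torus-p2` gen 10.  Infrastructure for the row bound of an INTERIOR-supported tensor table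
(part 3b): every first-order plaquette functional of layer F5c (`[edge]·w(o_p; 0) + rowFormC pp μ ν w`) is a finite linear combination
`Σ_{m ∈ [-2,2]³} F(m) • w(o, m)`; for tensor tables the coefficient functions are products of 1-D kernels, fine shifts act on one slot
(`fδ`), and the coarse `d2` of `ApproxLift.d2` acts by the adjoint difference `cΔ` on one slot.

* §1 `B2 = [-2,2]`, `boxSum F W = Σ_{a,b,c ∈ B2} F a b c • W ![a,b,c]`, five-term expansion, congruence/linearity;
* §2 SHIFTS: `boxSum F (W(· + e_i)) = boxSum (F shifted in slot i) W` for `F` vanishing on the slot-`i` faces `{2}`, `{-3}`;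
* §3 NORM: `‖boxSum F W‖ ≤ (Σ|F|)·B_w`, and the mass of a product `Σ|u·v·w| = (Σ|u|)(Σ|v|)(Σ|w|)`;
* §4 CONVERSION: `Σ_{k : Fin 3 → Fin 3} G(kvec k) • W (s + kvec 1 k) = boxSum G (W(s + ·))` for `G` supported in `[-1,1]³` (`sum_pi_fin3`).

Elementary; nothing of Bałaban's is asserted.
-/

noncomputable section

open scoped BigOperators

namespace Summit.QuantumFields.YangMills.Theorems.ApproxLift.AnsatzT

open Literature.MathematicalPhysics.QuantumFieldTheory.Balaban1983to89
open T4Continuum BlockAveraging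

/-! ## §1 The box and the box functional -/

/-- The coarse box `[-2, 2] ⊂ ℤ`. -/
def B2 : Finset ℤ := Finset.Icc (-2) 2

/-- `[-2,2] = {-2,-1,0,1,2}`. -/
theorem B2_eq : B2 = {-2, -1, 0, 1, 2} := by decide

/-- Five-term expansion of a sum over `[-2,2]`. -/
theorem sum_B2 {M : Type*} [AddCommMonoid M] (f : ℤ → M) : ∑ a ∈ B2, f a = f (-2) + f (-1) + f 0 + f 1 + f 2 := by
  rw [B2_eq, Finset.sum_insert (by decide), Finset.sum_insert (by decide), Finset.sum_insert (by decide),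
    Finset.sum_insert (by decide), Finset.sum_singleton]
  simp only [add_assoc]

section Box

variable {M : Type*} [AddCommGroup M] [Module ℂ M]

/-- **THE BOX FUNCTIONAL**: a real coefficient function on `[-2,2]³` against an `M`-valued field on `ℤ³`. -/
def boxSum (F : ℤ → ℤ → ℤ → ℝ) (W : (Fin 3 → ℤ) → M) : M :=
  ∑ a ∈ B2, ∑ b ∈ B2, ∑ c ∈ B2, ((F a b c : ℝ) : ℂ) • W ![a, b, c]

/-- Congruence on the box. -/
theorem boxSum_congr {F G : ℤ → ℤ → ℤ → ℝ} (W : (Fin 3 → ℤ) → M)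
    (h : ∀ a b c, a ∈ B2 → b ∈ B2 → c ∈ B2 → F a b c = G a b c) : boxSum F W = boxSum G W :=
  Finset.sum_congr rfl fun a ha => Finset.sum_congr rfl fun b hb => Finset.sum_congr rfl fun c hc => by rw [h a b c ha hb hc]

/-- Additivity in the coefficients. -/
theorem boxSum_add (F G : ℤ → ℤ → ℤ → ℝ) (W : (Fin 3 → ℤ) → M) :
    boxSum (fun a b c => F a b c + G a b c) W = boxSum F W + boxSum G W := by
  unfold boxSum
  simp only [Complex.ofReal_add, add_smul, Finset.sum_add_distrib]

/-- Subtraction in the coefficients. -/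
theorem boxSum_sub (F G : ℤ → ℤ → ℤ → ℝ) (W : (Fin 3 → ℤ) → M) :
    boxSum (fun a b c => F a b c - G a b c) W = boxSum F W - boxSum G W := by
  unfold boxSum
  simp only [Complex.ofReal_sub, sub_smul, Finset.sum_sub_distrib]

/-- Negation in the coefficients. -/
theorem boxSum_neg (F : ℤ → ℤ → ℤ → ℝ) (W : (Fin 3 → ℤ) → M) :
    boxSum (fun a b c => -F a b c) W = -boxSum F W := by
  unfold boxSum
  simp only [Complex.ofReal_neg, neg_smul, Finset.sum_neg_distrib]

/-- The field may be negated instead. -/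
theorem boxSum_neg_field (F : ℤ → ℤ → ℤ → ℝ) (W : (Fin 3 → ℤ) → M) :
    boxSum F (fun v => -W v) = -boxSum F W := by
  unfold boxSum
  simp only [smul_neg, Finset.sum_neg_distrib]

/-- The field may be split. -/
theorem boxSum_sub_field (F : ℤ → ℤ → ℤ → ℝ) (W W' : (Fin 3 → ℤ) → M) :
    boxSum F (fun v => W v - W' v) = boxSum F W - boxSum F W' := by
  unfold boxSum
  simp only [smul_sub, Finset.sum_sub_distrib]

/-- A coefficient function supported at the origin only. -/
theorem boxSum_single (x : ℝ) (W : (Fin 3 → ℤ) → M) :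
    boxSum (fun a b c => if a = 0 ∧ b = 0 ∧ c = 0 then x else 0) W = ((x : ℝ) : ℂ) • W 0 := by
  unfold boxSum
  have h0 : (0 : ℤ) ∈ B2 := by decide
  rw [Finset.sum_eq_single 0 (fun a _ ha => by simp [ha]) (fun h => absurd h0 h)]
  rw [Finset.sum_eq_single 0 (fun b _ hb => by simp [hb]) (fun h => absurd h0 h)]
  rw [Finset.sum_eq_single 0 (fun c _ hc => by simp [hc]) (fun h => absurd h0 h)]
  simp only [and_self, if_true]
  rw [show (![0, 0, 0] : Fin 3 → ℤ) = 0 from by funext i; fin_cases i <;> rfl]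

/-! ## §2 Shifts in one slot -/

omit [Module ℂ M] in
/-- Reindexing a five-term sum by one step (vanishing end terms). -/
theorem sum_B2_reindex (Φ : ℤ → ℤ → M) (h2 : ∀ t, Φ 2 t = 0) (h3 : ∀ t, Φ (-3) t = 0) :
    ∑ a ∈ B2, Φ a (a + 1) = ∑ a ∈ B2, Φ (a - 1) a := by
  rw [sum_B2, sum_B2]; norm_num; rw [h2, h3, add_zero, zero_add]

/-- `![a,b,c] + e_0 = ![a+1,b,c]` etc. -/
theorem vec3_add_unitZ_zero (a b c : ℤ) : (![a, b, c] : Fin 3 → ℤ) + unitZ 0 = ![a + 1, b, c] := by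
  funext i; fin_cases i <;> simp [unitZ]
/-- `![a,b,c] + e_1 = ![a,b+1,c]`. -/
theorem vec3_add_unitZ_one (a b c : ℤ) : (![a, b, c] : Fin 3 → ℤ) + unitZ 1 = ![a, b + 1, c] := by
  funext i; fin_cases i <;> simp [unitZ]
/-- `![a,b,c] + e_2 = ![a,b,c+1]`. -/
theorem vec3_add_unitZ_two (a b c : ℤ) : (![a, b, c] : Fin 3 → ℤ) + unitZ 2 = ![a, b, c + 1] := by
  funext i; fin_cases i <;> simp [unitZ]

/-- **SHIFT IN SLOT 0**: `boxSum F (W(· + e₀)) = boxSum F(·−1,·,·) W` for `F` vanishing on the slot-0 faces `a = 2`, `a = -3`. -/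
theorem boxSum_shift_zero (F : ℤ → ℤ → ℤ → ℝ) (W : (Fin 3 → ℤ) → M) (h2 : ∀ b c, F 2 b c = 0) (h3 : ∀ b c, F (-3) b c = 0) :
    boxSum F (fun v => W (v + unitZ 0)) = boxSum (fun a b c => F (a - 1) b c) W := by
  unfold boxSum
  simp_rw [vec3_add_unitZ_zero]
  exact sum_B2_reindex (fun a t => ∑ b ∈ B2, ∑ c ∈ B2, ((F a b c : ℝ) : ℂ) • W ![t, b, c])
    (fun t => by simp [h2]) (fun t => by simp [h3])

/-- **SHIFT IN SLOT 1**. -/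
theorem boxSum_shift_one (F : ℤ → ℤ → ℤ → ℝ) (W : (Fin 3 → ℤ) → M) (h2 : ∀ a c, F a 2 c = 0) (h3 : ∀ a c, F a (-3) c = 0) :
    boxSum F (fun v => W (v + unitZ 1)) = boxSum (fun a b c => F a (b - 1) c) W := by
  unfold boxSum
  simp_rw [vec3_add_unitZ_one]
  exact Finset.sum_congr rfl fun a _ =>
    sum_B2_reindex (fun b t => ∑ c ∈ B2, ((F a b c : ℝ) : ℂ) • W ![a, t, c]) (fun t => by simp [h2]) (fun t => by simp [h3])

/-- **SHIFT IN SLOT 2**. -/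
theorem boxSum_shift_two (F : ℤ → ℤ → ℤ → ℝ) (W : (Fin 3 → ℤ) → M) (h2 : ∀ a b, F a b 2 = 0) (h3 : ∀ a b, F a b (-3) = 0) :
    boxSum F (fun v => W (v + unitZ 2)) = boxSum (fun a b c => F a b (c - 1)) W := by
  unfold boxSum
  simp_rw [vec3_add_unitZ_two]
  exact Finset.sum_congr rfl fun a _ => Finset.sum_congr rfl fun b _ =>
    sum_B2_reindex (fun c t => ((F a b c : ℝ) : ℂ) • W ![a, b, t]) (fun t => by simp [h2]) (fun t => by simp [h3])

end Box

/-! ## §3 Norms -/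

section Norm

variable {M : Type*} [SeminormedAddCommGroup M] [NormedSpace ℂ M]

/-- **NORM OF THE BOX FUNCTIONAL**: `‖boxSum F W‖ ≤ (Σ_{box} |F|) · B_w`. -/
theorem norm_boxSum_le (F : ℤ → ℤ → ℤ → ℝ) {W : (Fin 3 → ℤ) → M} {Bw : ℝ} (hW : ∀ v, ‖W v‖ ≤ Bw) :
    ‖boxSum F W‖ ≤ (∑ a ∈ B2, ∑ b ∈ B2, ∑ c ∈ B2, |F a b c|) * Bw := by
  unfold boxSum
  rw [Finset.sum_mul]
  refine (norm_sum_le _ _).trans (Finset.sum_le_sum fun a _ => ?_)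
  rw [Finset.sum_mul]
  refine (norm_sum_le _ _).trans (Finset.sum_le_sum fun b _ => ?_)
  rw [Finset.sum_mul]
  refine (norm_sum_le _ _).trans (Finset.sum_le_sum fun c _ => ?_)
  rw [norm_smul, Complex.norm_real, Real.norm_eq_abs]
  exact mul_le_mul_of_nonneg_left (hW _) (abs_nonneg _)

/-- The mass of a product coefficient function factorises. -/
theorem boxMass_prod (u v w : ℤ → ℝ) :
    (∑ a ∈ B2, ∑ b ∈ B2, ∑ c ∈ B2, |u a * v b * w c|) = (∑ a ∈ B2, |u a|) * (∑ b ∈ B2, |v b|) * ∑ c ∈ B2, |w c| := by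
  simp_rw [abs_mul]
  symm
  rw [Finset.sum_mul_sum, Finset.sum_mul]
  refine Finset.sum_congr rfl fun a _ => ?_
  rw [Finset.sum_mul]
  refine Finset.sum_congr rfl fun b _ => ?_
  rw [Finset.mul_sum]

/-- The box mass of a kernel built by `mk3`: three components. -/
theorem sum_B2_abs_mk3 (fm fz fp : ℕ → ℝ) (p : ℕ) :
    ∑ a ∈ B2, |mk3 fm fz fp p a| = |fm p| + |fz p| + |fp p| := by
  rw [sum_B2]; simp [mk3]

end Norm

/-! ## §4 Conversion from the fleet's displacement sums -/

section Convert

variable {M : Type*} [AddCommGroup M] [Module ℂ M]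

omit [Module ℂ M] in
/-- Fubini for `Fin 3 → α`: a sum over functions is an iterated sum over the three values. -/
theorem sum_pi_fin3 {α : Type*} [Fintype α] (Φ : (Fin 3 → α) → M) :
    ∑ k, Φ k = ∑ a, ∑ b, ∑ c, Φ ![a, b, c] := by
  rw [← (Fin.consEquiv (fun _ => α)).sum_comp, Fintype.sum_prod_type]
  refine Fintype.sum_congr _ _ fun a => ?_
  rw [← (Fin.consEquiv (fun _ => α)).sum_comp, Fintype.sum_prod_type]
  refine Fintype.sum_congr _ _ fun b => ?_
  rw [← (Fin.consEquiv (fun _ => α)).sum_comp, Fintype.sum_prod_type]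
  refine Fintype.sum_congr _ _ fun c => ?_
  rw [Fintype.sum_unique]
  rfl

omit [Module ℂ M] in
/-- The three values of `Fin (2·1+1)` shifted by `−1` enumerate `{-1, 0, 1}`; as a sum over `[-2,2]` with vanishing ends. -/
theorem sum_fin3_eq_sum_B2 (g : ℤ → M) (h2 : g 2 = 0) (hm2 : g (-2) = 0) :
    ∑ t : Fin (2 * 1 + 1), g (((t : ℕ) : ℤ) - 1) = ∑ a ∈ B2, g a := by
  rw [sum_B2, hm2, h2, zero_add, add_zero, Fin.sum_univ_three]
  norm_num

/-- `kvec 1 ![a,b,c] = ![a-1, b-1, c-1]` componentwise. -/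
theorem kvec_vec3 (t₀ t₁ t₂ : Fin (2 * 1 + 1)) :
    kvec 1 (![t₀, t₁, t₂] : Fin 3 → Fin (2 * 1 + 1)) = ![(((t₀ : ℕ) : ℤ) - 1), (((t₁ : ℕ) : ℤ) - 1), (((t₂ : ℕ) : ℤ) - 1)] := by
  funext i; fin_cases i <;> simp [kvec]

/-- **CONVERSION**: a displacement sum of the fleet format with a coefficient `G(kvec k)` supported in `[-1,1]³` is the box functional of
`G` against the shifted field. -/
theorem sum_kvec_eq_boxSum (G : ℤ → ℤ → ℤ → ℝ) (W : (Fin 3 → ℤ) → M) (s : Fin 3 → ℤ)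
    (h0 : ∀ a b c, (a = 2 ∨ a = -2) → G a b c = 0) (h1 : ∀ a b c, (b = 2 ∨ b = -2) → G a b c = 0)
    (h2 : ∀ a b c, (c = 2 ∨ c = -2) → G a b c = 0) :
    ∑ k : Fin 3 → Fin (2 * 1 + 1), ((G (((k 0 : ℕ) : ℤ) - 1) (((k 1 : ℕ) : ℤ) - 1) (((k 2 : ℕ) : ℤ) - 1) : ℝ) : ℂ) • W (s + kvec 1 k) =
      boxSum G (fun v => W (s + v)) := by
  rw [sum_pi_fin3]
  unfold boxSum
  simp only [Matrix.cons_val_zero, Matrix.cons_val_one, Matrix.cons_val_two, Matrix.head_cons, Matrix.tail_cons, kvec_vec3]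
  rw [sum_fin3_eq_sum_B2 (fun a => ∑ t₁ : Fin (2 * 1 + 1), ∑ t₂ : Fin (2 * 1 + 1),
      ((G a (((t₁ : ℕ) : ℤ) - 1) (((t₂ : ℕ) : ℤ) - 1) : ℝ) : ℂ) • W (s + ![a, (((t₁ : ℕ) : ℤ) - 1), (((t₂ : ℕ) : ℤ) - 1)]))
    (by simp [h0]) (by simp [h0])]
  refine Finset.sum_congr rfl fun a _ => ?_
  rw [sum_fin3_eq_sum_B2 (fun b => ∑ t₂ : Fin (2 * 1 + 1), ((G a b (((t₂ : ℕ) : ℤ) - 1) : ℝ) : ℂ) • W (s + ![a, b, (((t₂ : ℕ) : ℤ) - 1)]))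
    (by simp [h1]) (by simp [h1])]
  refine Finset.sum_congr rfl fun b _ => ?_
  exact sum_fin3_eq_sum_B2 (fun c => ((G a b c : ℝ) : ℂ) • W (s + ![a, b, c])) (by simp [h2]) (by simp [h2])

end Convert

end Summit.QuantumFields.YangMills.Theorems.ApproxLift.AnsatzT

end
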